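import Mathlib.LinearAlgebra.Trace
import Mathlib.LinearAlgebra.QuadraticForm.Basic
import Mathlib.RingTheory.TensorProduct.Basic
import Literature.NumberTheory.Kottwitz1992.InvolutionsLemma27Holds
import HarnessLib

/-!
# [Kottwitz1992, §2] Lemma 2.3 (2) — DISCHARGED: `Kottwitz1992_2_3_2_tensor_prod_holds`

Kernel-lane companion of the statement carpet ★ `Literature/NumberTheory/Kottwitz1992/Involutions.lean` (squad TK, TK-t01): the named
fact ★ `Involutions.Kottwitz1992_2_3_2_tensor_prod` — «The tensor product (respectively, direct product) of positive involutions on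
semisimple algebras `B₁` and `B₂` is a positive involution on `B₁ ⊗_ℝ B₂` (respectively, `B₁ × B₂`)» — is PROVED here as
`theorem Kottwitz1992_2_3_2_tensor_prod_holds : Kottwitz1992_2_3_2_tensor_prod B ι B₂ ι₂`.  THEOREMS ONLY (no definition, no named fact,
no `sorry`, no instance, no notation); cell hodgecm-mathlib, seat B-typ04 (g29); net debt −1.  Imports ★ `InvolutionsLemma27Holds` for
Lemma 2.7 (`tr_{B/ℝ} b* = tr_{B/ℝ} b`, ★ `Kottwitz1992_2_7_trace_eq_holds`) BY NAME.

R. E. Kottwitz, *Points on some Shimura varieties over finite fields*, J. Amer. Math. Soc. 5 (1992), §2 Lemma 2.3 (2), p. 380 (held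
`paper:doi-10-2307-2152772`, p0008); print gives no separate proof for (2).  Made explicit for the tree's rendering of «positive»
(condition (3) of Lemma 2.2, ★ `IsPositiveInvolution`: `*` an involution and `tr(x x*) > 0` for `x ≠ 0`, `tr` = ★ `Automorphic.leftMulTrace`):
* DIRECT PRODUCT: `L_{(x,y)} = L_x × L_y`, so `tr_{B×B₂}((x,y)(x,y)*) = tr_B(x x*) + tr_{B₂}(y y*)` (Mathlib ★ `LinearMap.trace_prodMap'`), positive
  when `(x, y) ≠ 0`; the involution identities hold componentwise.
* TENSOR PRODUCT: the involution identities of `ι ⊗ ι₂` are checked on pure tensors (`TensorProduct.induction_on`).  Positivity: with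
  `L_{u⊗v} = L_u ⊗ L_v`, `tr_{B⊗B₂}(u ⊗ v) = tr_B(u) tr_{B₂}(v)` (Mathlib ★ `LinearMap.trace_tensorProduct'`), so on pure tensors the form
  `T(z, z′) = tr(z (ι⊗ι₂)z′)` is the product `T₁(a,a′) T₂(b,b′)` of the factor forms `T₁(a,a′) = tr_B(a ι a′)`, `T₂(b,b′) = tr_{B₂}(b ι₂ b′)`; these
  are positive definite by hypothesis and SYMMETRIC by Lemma 2.7 (`tr(a ιa′) = tr((a ιa′)*) = tr(a′ ιa)`), hence admit orthogonal bases
  `e`, `f` (Mathlib ★ `LinearMap.BilinForm.exists_orthogonal_basis`) with `d_i = T₁(e_i,e_i) > 0`, `d′_j = T₂(f_j,f_j) > 0`; expanding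
  `z = Σ c_{ij} e_i ⊗ f_j` in the basis `e ⊗ f` (★ `Module.Basis.tensorProduct`) gives `tr(z (ι⊗ι₂) z) = Σ c_{ij}² d_i d′_j > 0` for `z ≠ 0`.
HONEST LABEL: HC_CM is proved only modulo the 7 printed citations (2 remaining: hLiu418, h413) until rung 0 closes; this file adds no citation debt
(0 facts, 0 sorry) and discharges 1 named fact of ★ `Involutions`.

## References
* [Kottwitz1992] R. E. Kottwitz, Points on some Shimura varieties over finite fields, J. Amer. Math. Soc. 5 (1992) 373–444, §2 Lemma 2.3 (2)
  p. 380; Lemma 2.2 (3) p. 379 (the positivity condition); Lemma 2.7 p. 381.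
-/

noncomputable section

open TensorProduct

namespace Literature.NumberTheory.Kottwitz1992.Involutions

open Literature.NumberTheory.Automorphic (leftMulTrace leftMulTrace_apply)

universe u

section LemmaTwoThreeB

variable (B : Type u) [Ring B] [Algebra ℝ B] (ι : B →ₗ[ℝ] B)
variable (B₂ : Type u) [Ring B₂] [Algebra ℝ B₂] (ι₂ : B₂ →ₗ[ℝ] B₂)

variable {B ι} in
/-- `tr_{B/ℝ}(x x*) ≥ 0` for a positive involution (`> 0` off `0`, `= 0` at `0`). [cite: Kottwitz1992, Lemma 2.2 (3) (p. 379)] -/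
private theorem leftMulTrace_mul_self_nonneg (hpos : IsPositiveInvolution B ι) (x : B) : 0 ≤ leftMulTrace ℝ B (x * ι x) := by
  by_cases hx : x = 0
  · rw [hx, zero_mul, map_zero]
  · exact (hpos.trace_mul_self_pos x hx).le

/-! ### The direct product -/

variable {B B₂} in
/-- `tr_{B×B₂/ℝ}(x, y) = tr_{B/ℝ}(x) + tr_{B₂/ℝ}(y)` (`L_{(x,y)} = L_x × L_y`). [folklore] -/
private theorem leftMulTrace_prod [FiniteDimensional ℝ B] [FiniteDimensional ℝ B₂] (x : B) (y : B₂) :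
    leftMulTrace ℝ (B × B₂) (x, y) = leftMulTrace ℝ B x + leftMulTrace ℝ B₂ y := by
  rw [leftMulTrace_apply, leftMulTrace_apply, leftMulTrace_apply]
  have h : (Algebra.lmul ℝ (B × B₂) (x, y) : B × B₂ →ₗ[ℝ] B × B₂) = (Algebra.lmul ℝ B x).prodMap (Algebra.lmul ℝ B₂ y) := by
    apply LinearMap.ext
    rintro ⟨a, b⟩
    rfl
  rw [h, LinearMap.trace_prodMap']

/-- **Lemma 2.3 (2), direct product**: the product of positive involutions is a positive involution of `B × B₂`.
[cite: Kottwitz1992, Lemma 2.3 (2) (p. 380)] -/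
private theorem isPositiveInvolution_prod [FiniteDimensional ℝ B] [FiniteDimensional ℝ B₂] (h₁ : IsPositiveInvolution B ι)
    (h₂ : IsPositiveInvolution B₂ ι₂) : IsPositiveInvolution (B × B₂) (ι.prodMap ι₂) := by
  refine ⟨⟨fun x y => ?_, fun x => ?_⟩, fun x hx => ?_⟩
  · exact Prod.ext (h₁.map_mul x.1 y.1) (h₂.map_mul x.2 y.2)
  · exact Prod.ext (h₁.apply_apply x.1) (h₂.apply_apply x.2)
  · rw [LinearMap.prodMap_apply, Prod.mk_mul_mk, leftMulTrace_prod]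
    by_cases h0 : x.1 = 0
    · have h2 : x.2 ≠ 0 := fun h2 => hx (Prod.ext h0 h2)
      rw [h0, zero_mul, map_zero, zero_add]
      exact h₂.trace_mul_self_pos x.2 h2
    · exact add_pos_of_pos_of_nonneg (h₁.trace_mul_self_pos x.1 h0) (leftMulTrace_mul_self_nonneg h₂ x.2)

/-! ### The tensor product -/

variable {B B₂} in
/-- `tr_{B⊗B₂/ℝ}(u ⊗ v) = tr_{B/ℝ}(u) · tr_{B₂/ℝ}(v)` (`L_{u⊗v} = L_u ⊗ L_v`). [folklore] -/
private theorem leftMulTrace_tmul [FiniteDimensional ℝ B] [FiniteDimensional ℝ B₂] (u : B) (v : B₂) :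
    leftMulTrace ℝ (B ⊗[ℝ] B₂) (u ⊗ₜ[ℝ] v) = leftMulTrace ℝ B u * leftMulTrace ℝ B₂ v := by
  rw [leftMulTrace_apply, leftMulTrace_apply, leftMulTrace_apply]
  have h : (Algebra.lmul ℝ (B ⊗[ℝ] B₂) (u ⊗ₜ[ℝ] v) : B ⊗[ℝ] B₂ →ₗ[ℝ] B ⊗[ℝ] B₂) =
      TensorProduct.map (Algebra.lmul ℝ B u : B →ₗ[ℝ] B) (Algebra.lmul ℝ B₂ v : B₂ →ₗ[ℝ] B₂) := by
    apply TensorProduct.ext'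
    intro x y
    simp [Algebra.TensorProduct.tmul_mul_tmul]
  rw [h, LinearMap.trace_tensorProduct']

variable {B ι B₂ ι₂} in
/-- The involution identities of `ι ⊗ ι₂` on `B ⊗ B₂` (checked on pure tensors). [cite: Kottwitz1992, Lemma 2.3 (2) (p. 380)] -/
private theorem isInvolution_tensor (h₁ : IsInvolution ℝ B ι) (h₂ : IsInvolution ℝ B₂ ι₂) :
    IsInvolution ℝ (B ⊗[ℝ] B₂) (TensorProduct.map ι ι₂) := by
  refine ⟨fun z w => ?_, fun z => ?_⟩
  · induction z using TensorProduct.induction_on with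
    | zero => rw [zero_mul, map_zero, mul_zero]
    | tmul a b =>
      induction w using TensorProduct.induction_on with
      | zero => rw [mul_zero, map_zero, zero_mul]
      | tmul c d =>
        rw [Algebra.TensorProduct.tmul_mul_tmul, TensorProduct.map_tmul, TensorProduct.map_tmul, TensorProduct.map_tmul,
          Algebra.TensorProduct.tmul_mul_tmul, h₁.map_mul, h₂.map_mul]
      | add w₁ w₂ hw₁ hw₂ => rw [mul_add, map_add, hw₁, hw₂, map_add, add_mul]
    | add z₁ z₂ hz₁ hz₂ => rw [add_mul, map_add, hz₁, hz₂, map_add, mul_add]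
  · induction z using TensorProduct.induction_on with
    | zero => rw [map_zero, map_zero]
    | tmul a b => rw [TensorProduct.map_tmul, TensorProduct.map_tmul, h₁.apply_apply, h₂.apply_apply]
    | add z₁ z₂ hz₁ hz₂ => rw [map_add, map_add, hz₁, hz₂]

/-- **Lemma 2.3 (2), tensor product**: `ι ⊗ ι₂` is a positive involution of `B ⊗_ℝ B₂` — the form `tr(z (ι⊗ι₂) z′)` is the tensor
product of the positive definite SYMMETRIC (Lemma 2.7) forms `tr_B(a ι a′)`, `tr_{B₂}(b ι₂ b′)`; in orthogonal bases `e`, `f` of the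
factors, `tr(z (ι⊗ι₂) z) = Σ c_{ij}² d_i d′_j > 0` for `z = Σ c_{ij} e_i ⊗ f_j ≠ 0`. [cite: Kottwitz1992, Lemma 2.3 (2) (p. 380)] -/
private theorem isPositiveInvolution_tensor (hB : IsAlgebraWithInvolution B ι) (hB₂ : IsAlgebraWithInvolution B₂ ι₂)
    (h₁ : IsPositiveInvolution B ι) (h₂ : IsPositiveInvolution B₂ ι₂) :
    IsPositiveInvolution (B ⊗[ℝ] B₂) (TensorProduct.map ι ι₂) := by
  haveI : FiniteDimensional ℝ B := hB.finiteDimensional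
  haveI : FiniteDimensional ℝ B₂ := hB₂.finiteDimensional
  refine ⟨isInvolution_tensor h₁.toIsInvolution h₂.toIsInvolution, fun z hz => ?_⟩
  -- the two factor forms, symmetric by Lemma 2.7
  let T₁ : LinearMap.BilinForm ℝ B := LinearMap.mk₂ ℝ (fun a a' => leftMulTrace ℝ B (a * ι a'))
    (fun a a' c => by simp only [add_mul, map_add]) (fun r a c => by simp only [smul_mul_assoc, map_smul, smul_eq_mul])
    (fun a c c' => by simp only [map_add, mul_add]) (fun r a c => by simp only [map_smul, mul_smul_comm, smul_eq_mul])
  let T₂ : LinearMap.BilinForm ℝ B₂ := LinearMap.mk₂ ℝ (fun b b' => leftMulTrace ℝ B₂ (b * ι₂ b'))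
    (fun a a' c => by simp only [add_mul, map_add]) (fun r a c => by simp only [smul_mul_assoc, map_smul, smul_eq_mul])
    (fun a c c' => by simp only [map_add, mul_add]) (fun r a c => by simp only [map_smul, mul_smul_comm, smul_eq_mul])
  have hT₁ : ∀ a a', T₁ a a' = leftMulTrace ℝ B (a * ι a') := fun _ _ => rfl
  have hT₂ : ∀ b b', T₂ b b' = leftMulTrace ℝ B₂ (b * ι₂ b') := fun _ _ => rfl
  have hT₁s : T₁.IsSymm := by
    refine ⟨fun a a' => ?_⟩
    rw [hT₁, hT₁, (Kottwitz1992_2_7_trace_eq_holds B ι hB (a' * ι a)).2, h₁.map_mul, h₁.apply_apply]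
  have hT₂s : T₂.IsSymm := by
    refine ⟨fun b b' => ?_⟩
    rw [hT₂, hT₂, (Kottwitz1992_2_7_trace_eq_holds B₂ ι₂ hB₂ (b' * ι₂ b)).2, h₂.map_mul, h₂.apply_apply]
  haveI : Invertible (2 : ℝ) := invertibleOfNonzero two_ne_zero
  obtain ⟨e, he⟩ := LinearMap.BilinForm.exists_orthogonal_basis (LinearMap.BilinForm.isSymm_iff.mp hT₁s)
  obtain ⟨f, hf⟩ := LinearMap.BilinForm.exists_orthogonal_basis (LinearMap.BilinForm.isSymm_iff.mp hT₂s)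
  -- the product form on basis vectors
  set bas := e.tensorProduct f with hbas
  have hkey : ∀ p q : Fin (Module.finrank ℝ B) × Fin (Module.finrank ℝ B₂),
      leftMulTrace ℝ (B ⊗[ℝ] B₂) (bas p * TensorProduct.map ι ι₂ (bas q)) =
        if p = q then T₁ (e p.1) (e p.1) * T₂ (f p.2) (f p.2) else 0 := by
    intro p q
    rw [hbas, Module.Basis.tensorProduct_apply, Module.Basis.tensorProduct_apply, TensorProduct.map_tmul, Algebra.TensorProduct.tmul_mul_tmul,
      leftMulTrace_tmul, ← hT₁, ← hT₂]
    split_ifs with hpq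
    · rw [hpq]
    · rcases ne_or_eq p.1 q.1 with h1 | h1
      · rw [show T₁ (e p.1) (e q.1) = 0 from he h1, zero_mul]
      · have h2 : p.2 ≠ q.2 := fun h2 => hpq (Prod.ext h1 h2)
        rw [show T₂ (f p.2) (f q.2) = 0 from hf h2, mul_zero]
  -- expand `z` in the basis `e ⊗ f`
  set c := bas.repr z with hc
  have hz_sum : z = ∑ p, c p • bas p := (bas.sum_repr z).symm
  have hexp : leftMulTrace ℝ (B ⊗[ℝ] B₂) (z * TensorProduct.map ι ι₂ z) =
      ∑ p, c p * c p * (T₁ (e p.1) (e p.1) * T₂ (f p.2) (f p.2)) := by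
    have hκz : TensorProduct.map ι ι₂ z = ∑ q, c q • TensorProduct.map ι ι₂ (bas q) := by
      conv_lhs => rw [hz_sum]
      rw [map_sum]
      exact Finset.sum_congr rfl fun q _ => map_smul _ _ _
    rw [hκz, hz_sum, Finset.sum_mul_sum, map_sum]
    refine Finset.sum_congr rfl fun p _ => ?_
    rw [map_sum, Finset.sum_eq_single p]
    · rw [smul_mul_smul_comm, map_smul, hkey, if_pos rfl, smul_eq_mul]
    · intro q _ hqp
      rw [smul_mul_smul_comm, map_smul, hkey, if_neg (Ne.symm hqp), smul_zero]
    · intro hp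
      exact absurd (Finset.mem_univ p) hp
  rw [hexp]
  have hd : ∀ i, 0 < T₁ (e i) (e i) := fun i => by rw [hT₁]; exact h₁.trace_mul_self_pos _ (e.ne_zero i)
  have hd' : ∀ j, 0 < T₂ (f j) (f j) := fun j => by rw [hT₂]; exact h₂.trace_mul_self_pos _ (f.ne_zero j)
  obtain ⟨p₀, hp₀⟩ : ∃ p, c p ≠ 0 := by
    by_contra hall
    push Not at hall
    apply hz
    rw [hz_sum]
    exact Finset.sum_eq_zero fun p _ => by rw [hall p, zero_smul]
  refine Finset.sum_pos' (fun p _ => mul_nonneg (mul_self_nonneg _) (mul_pos (hd _) (hd' _)).le)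
    ⟨p₀, Finset.mem_univ _, mul_pos (mul_self_pos.mpr hp₀) (mul_pos (hd _) (hd' _))⟩

/-- **Lemma 2.3 (2), PROVED**: ★ `Kottwitz1992_2_3_2_tensor_prod` holds — «The tensor product (respectively, direct product) of positive
involutions on semisimple algebras `B₁` and `B₂` is a positive involution on `B₁ ⊗_ℝ B₂` (respectively, `B₁ × B₂`).»
[cite: Kottwitz1992, Lemma 2.3 (2) (p. 380)] -/
theorem Kottwitz1992_2_3_2_tensor_prod_holds : Kottwitz1992_2_3_2_tensor_prod B ι B₂ ι₂ := by
  intro hB hB₂ h₁ h₂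
  haveI : FiniteDimensional ℝ B := hB.finiteDimensional
  haveI : FiniteDimensional ℝ B₂ := hB₂.finiteDimensional
  exact ⟨isPositiveInvolution_tensor B ι B₂ ι₂ hB hB₂ h₁ h₂, isPositiveInvolution_prod B ι B₂ ι₂ h₁ h₂⟩

end LemmaTwoThreeB

end Literature.NumberTheory.Kottwitz1992.Involutions

end
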